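import Mathlib
import HarnessLib
import Summits.ResolutionOfSingularities.ResolutionOfSingularities.Theorems.HomologicalConductorPersistenceMonomialCurveQuotient
import Summits.ResolutionOfSingularities.ResolutionOfSingularities.Theorems.HomologicalConductorPersistenceMonomialCurveIdeal

/-!
# The one-square rule as an IDEAL equality: `ca(k[z,t][x]/(x² + zᵐ − εᵐtⁿ)) = (x̄, z̄ⁱt̄ᴹ : i < m, (m−1)(n−1) ≤ ni + mM)`

Route `ResolutionOfSingularities/HomologicalConductor`, chain W4.4b, rung S-2 `PersistenceSurface`
(stmt-ResolutionOfSingularities-19970), curve-exact cell; seat res-L1-w44b-stub-2 (gen 5).  [OURS · L1 w44b; AI-written, weaker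
than expert review; NOT a statement of the manuscript under study (Hironaka 2017), and no statement of that manuscript is used.]

The census seats quote the centre of a double-point stage as an ideal («`ca(x² + g) = (x) + 𝔠(g)`», S2-BRIEF R4; CA-CURVE table).
`…PersistenceMonomialCurveQuotient` (p564059) decides membership for the coprime Brieskorn double points and
`…PersistenceMonomialCurveIdeal` (p564409) gives the monomial ideal on the `AdjoinRoot` model of the curve.  Here:

* `cohomologyAnnihilator_quotient_eq_span_monomials` — on `R₀ = k[z,t]/(h)`, `h = zᵐ − εᵐtⁿ`:
  `ca(R₀) = Ideal.span {z̄ⁱ t̄ᴹ : i < m, (m−1)(n−1) ≤ ni + mM}` (transport along the ring isomorphism `ψ̄` of p564059);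
* **`cohomologyAnnihilator_doublePoint_eq_span`** — for `T = k[z,t][x]/(x² + h)` (`AdjoinRoot (X² + C h)` over `k[z,t]`,
  `char k ≠ 2`, `ε ≠ 0`, coprime `m, n > 1`):
  **`ca(T) = Ideal.span ({x̄} ∪ {z̄ⁱ t̄ᴹ : i < m, (m−1)(n−1) ≤ ni + mM})`** — `BranchedCoverDescent.cohomologyAnnihilator_eq_comap`
  (`ca(T) = π⁻¹ ca(R₀)`), `π` surjective with kernel `(x̄)` (`ker_lift_eq`), `Ideal.comap_map_of_surjective`.
  Instances: `A_{2j}`: `(x̄, z̄, t̄ʲ)`; `E₆`: `(x̄, z̄², z̄t̄, t̄²)`; `E₈`: `(x̄, z̄², z̄t̄, t̄³)`; `E₁₂ = (3,7)`: `(x̄, z̄², z̄t̄², t̄⁴)`;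
  `W₁₂ = (4,5)`: `(x̄, z̄³, z̄²t̄, z̄t̄², t̄³)` — every level, every field of characteristic `≠ 2`, fact-free.

References (mechanism only): S. B. Iyengar, R. Takahashi, IMRN 2016 §2 [`IyengarTakahashi2014`]; Ö. Esentepe, J. Algebra 541
(2020) Thm 4.4 / 5.4 [`Esentepe2020`] (statement shapes only).
-/

noncomputable section

-- single-problem summit: the doubled namespace component `ResolutionOfSingularities` is forced
set_option linter.dupNamespace false

namespace Summit.ResolutionOfSingularities.ResolutionOfSingularities.Theorems.HomologicalConductor.DoublePointIdeal

open Polynomial Literature.RingTheory.CohomologyAnnihilator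
open Summit.ResolutionOfSingularities.ResolutionOfSingularities.Theorems.HomologicalConductor.MonomialCusp
  (param_eq_zero_of_mem_span)
open Summit.ResolutionOfSingularities.ResolutionOfSingularities.Theorems.HomologicalConductor.MonomialCurveExact
open Summit.ResolutionOfSingularities.ResolutionOfSingularities.Theorems.HomologicalConductor.MonomialCurveQuotient
open Summit.ResolutionOfSingularities.ResolutionOfSingularities.Theorems.HomologicalConductor.MonomialCurveIdeal
open Summit.ResolutionOfSingularities.ResolutionOfSingularities.Theorems.HomologicalConductor.BranchedCoverDescent
  (cohomologyAnnihilator_eq_comap ker_lift_eq)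

universe u

variable (k : Type u) [Field k] (ε : k) (m n : ℕ)

/-! ## §1 The monomial ideal on `k[z,t]/(h)` -/

/-- The comparison `ψ̄` maps `z̄ⁱ t̄ᴹ` to `z̄ⁱ t̄ᴹ`. [folklore] -/
theorem quotientMap_mk_monomial (i M : ℕ) :
    Ideal.Quotient.lift (Ideal.span {(MvPolynomial.X 0 ^ m - MvPolynomial.C (ε ^ m) * MvPolynomial.X 1 ^ n : MvPolynomial (Fin 2) k)}) ((MvPolynomial.aeval (R := k) (![AdjoinRoot.root (X ^ m - C (C (ε ^ m) * X ^ n) : Polynomial (Polynomial k)), AdjoinRoot.of (X ^ m - C (C (ε ^ m) * X ^ n) : Polynomial (Polynomial k)) X] : Fin 2 → AdjoinRoot (X ^ m - C (C (ε ^ m) * X ^ n) : Polynomial (Polynomial k))))).toRingHom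
        (fun _ ha => aeval_eq_zero_of_mem_span k ε m n ha) (Ideal.Quotient.mk _ (MvPolynomial.X 0 ^ i * MvPolynomial.X 1 ^ M)) =
      AdjoinRoot.root (X ^ m - C (C (ε ^ m) * X ^ n) : Polynomial (Polynomial k)) ^ i * AdjoinRoot.of (X ^ m - C (C (ε ^ m) * X ^ n) : Polynomial (Polynomial k)) X ^ M := by
  rw [Ideal.Quotient.lift_mk, AlgHom.toRingHom_eq_coe, RingHom.coe_coe, map_mul (MvPolynomial.aeval (R := k) (![AdjoinRoot.root (X ^ m - C (C (ε ^ m) * X ^ n) : Polynomial (Polynomial k)), AdjoinRoot.of (X ^ m - C (C (ε ^ m) * X ^ n) : Polynomial (Polynomial k)) X] : Fin 2 → AdjoinRoot (X ^ m - C (C (ε ^ m) * X ^ n) : Polynomial (Polynomial k)))), map_pow (MvPolynomial.aeval (R := k) (![AdjoinRoot.root (X ^ m - C (C (ε ^ m) * X ^ n) : Polynomial (Polynomial k)), AdjoinRoot.of (X ^ m - C (C (ε ^ m) * X ^ n) : Polynomial (Polynomial k)) X] : Fin 2 → AdjoinRoot (X ^ m - C (C (ε ^ m) * X ^ n) : Polynomial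 (Polynomial k)))), map_pow (MvPolynomial.aeval (R := k) (![AdjoinRoot.root (X ^ m - C (C (ε ^ m) * X ^ n) : Polynomial (Polynomial k)), AdjoinRoot.of (X ^ m - C (C (ε ^ m) * X ^ n) : Polynomial (Polynomial k)) X] : Fin 2 → AdjoinRoot (X ^ m - C (C (ε ^ m) * X ^ n) : Polynomial (Polynomial k)))),
    MvPolynomial.aeval_X, MvPolynomial.aeval_X]
  simp only [Matrix.cons_val_zero, Matrix.cons_val_one]

/-- **`ca(k[z,t]/(zᵐ − εᵐtⁿ)) = Ideal.span {z̄ⁱ t̄ᴹ : i < m, (m−1)(n−1) ≤ ni + mM}`** (`ε ≠ 0`, coprime `m, n > 1`). [folklore] -/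
theorem cohomologyAnnihilator_quotient_eq_span_monomials (hε : ε ≠ 0) (hmn : Nat.Coprime m n) (hm : 1 < m) (hn : 1 < n) :
    cohomologyAnnihilator (MvPolynomial (Fin 2) k ⧸ Ideal.span {(MvPolynomial.X 0 ^ m - MvPolynomial.C (ε ^ m) * MvPolynomial.X 1 ^ n : MvPolynomial (Fin 2) k)}) =
      Ideal.span {r | ∃ i M : ℕ, i < m ∧ (m - 1) * (n - 1) ≤ n * i + m * M ∧
        r = Ideal.Quotient.mk (Ideal.span {(MvPolynomial.X 0 ^ m - MvPolynomial.C (ε ^ m) * MvPolynomial.X 1 ^ n : MvPolynomial (Fin 2) k)}) (MvPolynomial.X 0 ^ i * MvPolynomial.X 1 ^ M)} := by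
  have hbij : Function.Bijective (Ideal.Quotient.lift (Ideal.span {(MvPolynomial.X 0 ^ m - MvPolynomial.C (ε ^ m) * MvPolynomial.X 1 ^ n : MvPolynomial (Fin 2) k)}) ((MvPolynomial.aeval (R := k) (![AdjoinRoot.root (X ^ m - C (C (ε ^ m) * X ^ n) : Polynomial (Polynomial k)), AdjoinRoot.of (X ^ m - C (C (ε ^ m) * X ^ n) : Polynomial (Polynomial k)) X] : Fin 2 → AdjoinRoot (X ^ m - C (C (ε ^ m) * X ^ n) : Polynomial (Polynomial k))))).toRingHom
        (fun _ ha => aeval_eq_zero_of_mem_span k ε m n ha)) :=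
    ⟨injective_quotientMap k ε m n hε hmn (by omega), surjective_quotientMap k ε m n⟩
  set ψ := Ideal.Quotient.lift (Ideal.span {(MvPolynomial.X 0 ^ m - MvPolynomial.C (ε ^ m) * MvPolynomial.X 1 ^ n : MvPolynomial (Fin 2) k)}) ((MvPolynomial.aeval (R := k) (![AdjoinRoot.root (X ^ m - C (C (ε ^ m) * X ^ n) : Polynomial (Polynomial k)), AdjoinRoot.of (X ^ m - C (C (ε ^ m) * X ^ n) : Polynomial (Polynomial k)) X] : Fin 2 → AdjoinRoot (X ^ m - C (C (ε ^ m) * X ^ n) : Polynomial (Polynomial k))))).toRingHom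
        (fun _ ha => aeval_eq_zero_of_mem_span k ε m n ha) with hψ
  -- `(span S_R).map ψ = span S_A = ca(AdjoinRoot f) = (ca R₀).map ψ`, then pull back by the bijection `ψ`
  have hmap : (Ideal.span {r | ∃ i M : ℕ, i < m ∧ (m - 1) * (n - 1) ≤ n * i + m * M ∧
        r = Ideal.Quotient.mk (Ideal.span {(MvPolynomial.X 0 ^ m - MvPolynomial.C (ε ^ m) * MvPolynomial.X 1 ^ n : MvPolynomial (Fin 2) k)}) (MvPolynomial.X 0 ^ i * MvPolynomial.X 1 ^ M)}).map ψ =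
      Ideal.span {r | ∃ i M : ℕ, i < m ∧ (m - 1) * (n - 1) ≤ n * i + m * M ∧
        r = AdjoinRoot.root (X ^ m - C (C (ε ^ m) * X ^ n) : Polynomial (Polynomial k)) ^ i * AdjoinRoot.of (X ^ m - C (C (ε ^ m) * X ^ n) : Polynomial (Polynomial k)) X ^ M} := by
    rw [Ideal.map_span]
    congr 1
    ext r
    constructor
    · rintro ⟨r', ⟨i, M, hi, hiM, rfl⟩, rfl⟩
      exact ⟨i, M, hi, hiM, by rw [hψ, quotientMap_mk_monomial]⟩
    · rintro ⟨i, M, hi, hiM, rfl⟩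
      exact ⟨_, ⟨i, M, hi, hiM, rfl⟩, by rw [hψ, quotientMap_mk_monomial]⟩
  have hca : (cohomologyAnnihilator (MvPolynomial (Fin 2) k ⧸ Ideal.span {(MvPolynomial.X 0 ^ m - MvPolynomial.C (ε ^ m) * MvPolynomial.X 1 ^ n : MvPolynomial (Fin 2) k)})).map ψ =
      cohomologyAnnihilator (AdjoinRoot (X ^ m - C (C (ε ^ m) * X ^ n) : Polynomial (Polynomial k))) := by
    have := map_ringEquiv_cohomologyAnnihilator (RingEquiv.ofBijective ψ hbij)
    exact this
  rw [← Ideal.comap_map_of_bijective ψ hbij (I := cohomologyAnnihilator _), hca,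
    cohomologyAnnihilator_eq_span_monomials k ε m n hε hmn hm hn, ← hmap, Ideal.comap_map_of_bijective ψ hbij]

/-! ## §2 The double point `x² + h`: `ca(T) = (x̄) ⊔ (monomials)` -/

/-- `π : T → k[z,t]/(h)` (`x ↦ 0`) is surjective. [folklore] -/
theorem surjective_proj :
    Function.Surjective (AdjoinRoot.lift (Ideal.Quotient.mk (Ideal.span {(MvPolynomial.X 0 ^ m - MvPolynomial.C (ε ^ m) * MvPolynomial.X 1 ^ n : MvPolynomial (Fin 2) k)})) (0 : MvPolynomial (Fin 2) k ⧸ Ideal.span {(MvPolynomial.X 0 ^ m - MvPolynomial.C (ε ^ m) * MvPolynomial.X 1 ^ n : MvPolynomial (Fin 2) k)})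
          (by rw [eval₂_add, eval₂_X_pow, eval₂_C, zero_pow (by omega), zero_add,
                Ideal.Quotient.eq_zero_iff_mem]; exact Ideal.mem_span_singleton_self _) :
          AdjoinRoot (X ^ 2 + C (MvPolynomial.X 0 ^ m - MvPolynomial.C (ε ^ m) * MvPolynomial.X 1 ^ n : MvPolynomial (Fin 2) k) : Polynomial (MvPolynomial (Fin 2) k)) →+*
            MvPolynomial (Fin 2) k ⧸ Ideal.span {(MvPolynomial.X 0 ^ m - MvPolynomial.C (ε ^ m) * MvPolynomial.X 1 ^ n : MvPolynomial (Fin 2) k)}) := by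
  intro r
  obtain ⟨g, rfl⟩ := Ideal.Quotient.mk_surjective r
  exact ⟨AdjoinRoot.of _ g, by rw [AdjoinRoot.lift_of]⟩

/-- **THE ONE-SQUARE RULE AS AN IDEAL**: `k` a field with `2 ≠ 0`, `ε ≠ 0`, coprime `m, n > 1`,
`T = k[z,t][x]/(x² + (zᵐ − εᵐtⁿ))`.  Then
`ca(T) = Ideal.span ({x̄} ∪ {z̄ⁱ t̄ᴹ : i < m, (m−1)(n−1) ≤ ni + mM})`. [folklore] -/
theorem cohomologyAnnihilator_doublePoint_eq_span (h2 : (2 : k) ≠ 0) (hε : ε ≠ 0) (hmn : Nat.Coprime m n)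
    (hm : 1 < m) (hn : 1 < n) :
    cohomologyAnnihilator (AdjoinRoot (X ^ 2 + C (MvPolynomial.X 0 ^ m - MvPolynomial.C (ε ^ m) * MvPolynomial.X 1 ^ n : MvPolynomial (Fin 2) k) : Polynomial (MvPolynomial (Fin 2) k))) =
      Ideal.span ({AdjoinRoot.root (X ^ 2 + C (MvPolynomial.X 0 ^ m - MvPolynomial.C (ε ^ m) * MvPolynomial.X 1 ^ n : MvPolynomial (Fin 2) k) : Polynomial (MvPolynomial (Fin 2) k))} ∪
        {r | ∃ i M : ℕ, i < m ∧ (m - 1) * (n - 1) ≤ n * i + m * M ∧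
          r = AdjoinRoot.of (X ^ 2 + C (MvPolynomial.X 0 ^ m - MvPolynomial.C (ε ^ m) * MvPolynomial.X 1 ^ n : MvPolynomial (Fin 2) k) : Polynomial (MvPolynomial (Fin 2) k))
            (MvPolynomial.X 0 ^ i * MvPolynomial.X 1 ^ M)}) := by
  have hf : (MvPolynomial.X 0 ^ m - MvPolynomial.C (ε ^ m) * MvPolynomial.X 1 ^ n : MvPolynomial (Fin 2) k) ∈ nonZeroDivisors (MvPolynomial (Fin 2) k) :=
    mem_nonZeroDivisors_of_ne_zero (h_ne_zero k ε m n (by omega))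
  have hu : IsUnit (2 : MvPolynomial (Fin 2) k) := by
    have := (isUnit_iff_ne_zero.mpr h2).map (MvPolynomial.C : k →+* MvPolynomial (Fin 2) k)
    rwa [map_ofNat] at this
  rw [cohomologyAnnihilator_eq_comap (MvPolynomial.X 0 ^ m - MvPolynomial.C (ε ^ m) * MvPolynomial.X 1 ^ n : MvPolynomial (Fin 2) k) hf (d := 2) (cohomologyAnnihilatorOfDegree_polynomial_mvPolynomial_two_eq_top k)
    hu, cohomologyAnnihilator_quotient_eq_span_monomials k ε m n hε hmn hm hn]
  set π := (AdjoinRoot.lift (Ideal.Quotient.mk (Ideal.span {(MvPolynomial.X 0 ^ m - MvPolynomial.C (ε ^ m) * MvPolynomial.X 1 ^ n : MvPolynomial (Fin 2) k)})) (0 : MvPolynomial (Fin 2) k ⧸ Ideal.span {(MvPolynomial.X 0 ^ m - MvPolynomial.C (ε ^ m) * MvPolynomial.X 1 ^ n : MvPolynomial (Fin 2) k)})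
          (by rw [eval₂_add, eval₂_X_pow, eval₂_C, zero_pow (by omega), zero_add,
                Ideal.Quotient.eq_zero_iff_mem]; exact Ideal.mem_span_singleton_self _) :
          AdjoinRoot (X ^ 2 + C (MvPolynomial.X 0 ^ m - MvPolynomial.C (ε ^ m) * MvPolynomial.X 1 ^ n : MvPolynomial (Fin 2) k) : Polynomial (MvPolynomial (Fin 2) k)) →+*
            MvPolynomial (Fin 2) k ⧸ Ideal.span {(MvPolynomial.X 0 ^ m - MvPolynomial.C (ε ^ m) * MvPolynomial.X 1 ^ n : MvPolynomial (Fin 2) k)}) with hπ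
  -- `span S_R = map π (span S_T)`
  have hmap : Ideal.span {r | ∃ i M : ℕ, i < m ∧ (m - 1) * (n - 1) ≤ n * i + m * M ∧
        r = Ideal.Quotient.mk (Ideal.span {(MvPolynomial.X 0 ^ m - MvPolynomial.C (ε ^ m) * MvPolynomial.X 1 ^ n : MvPolynomial (Fin 2) k)}) (MvPolynomial.X 0 ^ i * MvPolynomial.X 1 ^ M)} =
      (Ideal.span {r | ∃ i M : ℕ, i < m ∧ (m - 1) * (n - 1) ≤ n * i + m * M ∧
          r = AdjoinRoot.of (X ^ 2 + C (MvPolynomial.X 0 ^ m - MvPolynomial.C (ε ^ m) * MvPolynomial.X 1 ^ n : MvPolynomial (Fin 2) k) : Polynomial (MvPolynomial (Fin 2) k))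
            (MvPolynomial.X 0 ^ i * MvPolynomial.X 1 ^ M)}).map π := by
    rw [Ideal.map_span]
    congr 1
    ext r
    constructor
    · rintro ⟨i, M, hi, hiM, rfl⟩
      exact ⟨_, ⟨i, M, hi, hiM, rfl⟩, by rw [hπ, AdjoinRoot.lift_of]⟩
    · rintro ⟨r', ⟨i, M, hi, hiM, rfl⟩, rfl⟩
      exact ⟨i, M, hi, hiM, by rw [hπ, AdjoinRoot.lift_of]⟩
  rw [hmap, Ideal.comap_map_of_surjective π (surjective_proj k ε m n), ← RingHom.ker_eq_comap_bot, hπ,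
    ker_lift_eq (MvPolynomial.X 0 ^ m - MvPolynomial.C (ε ^ m) * MvPolynomial.X 1 ^ n : MvPolynomial (Fin 2) k) (le_refl 2), Ideal.span_union, sup_comm]

end Summit.ResolutionOfSingularities.ResolutionOfSingularities.Theorems.HomologicalConductor.DoublePointIdeal

end
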